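import Literature.NumberTheory.EllipticCurves.HalfIntegralWeightForms
import Literature.NumberTheory.EllipticCurves.ModularCurveEtaMultiplierProofs
import HarnessLib

/-!
# The automorphy factor of weight `1/2`: `θ(γz) = ε_d⁻¹ (c/d) √(cz + d) θ(z)` on `Γ₀(4)`

First step of the proof of Shimura 1973, Theorem 1.7 (`Shimura1973_heckeTSq_mem` in
`HalfIntegralWeightForms`): the transformation law of Shimura's theta function
`θ(z) = ∑_{n ∈ ℤ} e^{2πi n² z}` (`shimuraTheta`, `= jacobiTheta (2z)`) under the whole group
`Γ₀(4)`, with the multiplier in closed form. For `γ = (a b; c d) ∈ Γ₀(4)` and `z ∈ ℍ`,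

  `θ(γz) = ε_d⁻¹ · (c/d) · √(cz + d) · θ(z)`        (`shimuraTheta_smul_eq`)

where `ε_d = 1` if `d ≡ 1 (mod 4)` and `ε_d = i` if `d ≡ 3 (mod 4)` (`thetaEps`; `d` is odd, and
negative `d` are reduced modulo `4` as well), `√` is the principal branch (Mathlib's
`Complex.sqrt`, argument in `(-π/2, π/2]`), and `(c/d)` is Shimura's extension of the Jacobi
symbol (`shimuraSymbol c d = (c/|d|)`, multiplied by `-1` when `c < 0` and `d < 0`;
`(0/±1) = 1`). This is the automorphy factor `j(γ, z) = θ(γz)/θ(z) = ε_d⁻¹ (c/d) (cz + d)^{1/2}`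
of Shimura 1973, §1; also Koblitz GTM 97, Ch. IV, §1, Theorem, and — for `ϑ(τ) = θ(τ/2)` on the
theta group — Knopp 1970, Ch. 4, Thm. 3. With these conventions the right-hand side is
invariant under `γ ↦ -γ` (`thetaFactor_neg`), so no normalisation of the sign of `γ` is needed.

## Proof

Mathlib has the two transformation laws of `jacobiTheta` under the generators of the theta
group, `jacobiTheta_two_add` and `jacobiTheta_S_smul` (`ϑ(-1/τ) = (-iτ)^{1/2} ϑ(τ)`); Knopp's
derivation of the closed formula goes through `ϑ(τ) = η²((τ+1)/2)/η(τ+1)` (Jacobi's triple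
product), which is not available. Instead we run the induction over words directly on
`Γ₀(4) = ⟨T, W, -1⟩`, `T = (1 1; 0 1)`, `W = (1 0; 4 1)`, organised as a strong induction on
`|c|`: for `c ≠ 0` there are `n, m ∈ ℤ` with `|c(γ Tⁿ Wᵐ)| < |c|` (`exists_descent`: first make
`|d + nc| < |c|/2`, which is possible because `d` is odd and `c/2` is even, then
`|c + 4m d'| ≤ 2|d'|`). The inputs are

* `θ(z + 1) = θ(z)` (`shimuraTheta_T_smul`, in `HalfIntegralWeightForms`) and
  `θ(z/(4z + 1)) = √(4z + 1) θ(z)` (`shimuraTheta_W4_smul`), obtained from `jacobiTheta_S_smul`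
  applied twice (`z/(4z+1) = S(-2 + S(2z))/2`); the product of the two square roots is the
  principal one because both radicands `-iτ` have positive real part (`csqrt_mul_of_re_pos`);
* the step `γ ↦ γT^{±1}`: `ε_{d ± c} = ε_d` (`4 ∣ c`) and `(c/d ± c) = (c/d)`, which is the
  tree's `jacobiSym_even_shift` (Knopp, Ch. 4, case 1 (b)) with the sign `+` because `4 ∣ c`
  (`shimuraSymbol_add_self`);
* the step `γ ↦ γW^{±1}`: `(c ± 4d / d) = (c/d)` and the branch relation
  `√(X/u) √u = √X` for `u ∈ ℍ`, `Im X ≥ 0`, `X ≠ 0` (`csqrt_div_mul_csqrt`), after reducing to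
  a non-negative new `c` with `thetaFactor_neg`;
* the base case `c = 0`, `γ = ±Tᵇ`.

## Main statements

* `shimuraTheta_W4_smul`: `θ(z/(4z+1)) = √(4z+1) θ(z)`.
* `shimuraTheta_smul_eq`: the transformation law on `Γ₀(4)` (Shimura 1973, §1).
* `thetaFactor_neg`, `thetaFactor_ne_zero`, `thetaFactor_sq` (`j(γ,z)² = χ₋₄(d)(cz + d)`, i.e.
  `θ² |₁ γ = χ₋₄(d) θ²`).

## References

* G. Shimura, *On modular forms of half integral weight*, Ann. of Math. 97 (1973) 440–481, §1
  (the theta function `θ`, the symbol `(c/d)` and `ε_d`, the factor `j(γ, z)`). Not held while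
  this file was written; statements located through Koblitz IV §1 and Knopp Ch. 4.
  [Shimura1973HalfIntegral]
* M. I. Knopp, *Modular functions in analytic number theory* (1970), Ch. 4, Thm. 3 (the
  multiplier system of `ϑ`), Ch. 3, Thm. 13. [Knopp1970]
* N. Koblitz, *Introduction to elliptic curves and modular forms*, GTM 97, Ch. IV, §1.
-/

noncomputable section

open UpperHalfPlane hiding I
open Complex ModularGroup Matrix.SpecialLinearGroup CongruenceSubgroup
open scoped MatrixGroups Real NumberTheorySymbols

namespace Literature.NumberTheory.EllipticCurves.ModularForms

/-! ### Principal square roots: uniqueness and two branch relations -/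

/-- `Re √a ≥ 0` for the principal square root. [folklore] -/
theorem csqrt_re_nonneg (a : ℂ) : 0 ≤ (Complex.sqrt a).re := by
  rw [Complex.sqrt, Complex.cpow_inv_two_re]
  exact Real.sqrt_nonneg _

/-- If `Re √a = 0` then `Im √a ≥ 0` (the principal square root has argument in `(-π/2, π/2]`).
[folklore] -/
theorem csqrt_im_nonneg_of_re_eq_zero {a : ℂ} (h : (Complex.sqrt a).re = 0) :
    0 ≤ (Complex.sqrt a).im := by
  rw [Complex.sqrt, Complex.cpow_inv_two_re] at h
  have h1 : (‖a‖ + a.re) / 2 ≤ 0 := by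
    by_contra hlt
    push Not at hlt
    exact (Real.sqrt_pos.mpr hlt).ne' h
  have habs : |a.re| ≤ ‖a‖ := Complex.abs_re_le_norm a
  have hre : a.re = -‖a‖ := by linarith [neg_abs_le a.re]
  have him : a.im = 0 := by
    have h2 : ‖a‖ ^ 2 = a.re ^ 2 + a.im ^ 2 := by
      rw [Complex.sq_norm, Complex.normSq_apply]; ring
    rw [hre] at h2
    nlinarith
  rw [Complex.sqrt, Complex.cpow_inv_two_im_eq_sqrt him.ge]
  exact Real.sqrt_nonneg _

/-- **Uniqueness of the principal square root**: if `s² = t` and `s` lies in the region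
`{Re > 0} ∪ {Re = 0, Im ≥ 0}`, then `√t = s`. [folklore] -/
theorem csqrt_eq_of_sq_eq' {s t : ℂ} (hs : s ^ 2 = t) (hP : 0 < s.re ∨ (s.re = 0 ∧ 0 ≤ s.im)) :
    Complex.sqrt t = s := by
  have hsq : Complex.sqrt t ^ 2 = s ^ 2 := by rw [csqrt_sq, hs]
  rcases sq_eq_sq_iff_eq_or_eq_neg.mp hsq with h | h
  · exact h
  · have hre := csqrt_re_nonneg t
    rw [h, Complex.neg_re] at hre
    have hre0 : s.re = 0 := by
      rcases hP with hP | hP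
      · linarith
      · exact hP.1
    have him0 : 0 ≤ s.im := by
      rcases hP with hP | hP
      · linarith
      · exact hP.2
    have him := csqrt_im_nonneg_of_re_eq_zero (a := t) (by rw [h, Complex.neg_re, hre0, neg_zero])
    rw [h, Complex.neg_im] at him
    have hs0 : s = 0 := Complex.ext (by simpa using hre0) (by simp; linarith)
    rw [h, hs0, neg_zero]

/-- `√(-w) = -i √w` for `w` in the upper half-plane. [folklore] -/
theorem csqrt_neg_of_im_pos {w : ℂ} (hw : 0 < w.im) :
    Complex.sqrt (-w) = -I * Complex.sqrt w := by
  apply csqrt_eq_of_sq_eq'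
  · rw [mul_pow, csqrt_sq]
    have : (-I) ^ 2 = -1 := by rw [neg_pow_two, I_sq]
    rw [this]; ring
  · left
    have hq := csqrt_mem_quadrant hw
    simpa using hq.2

/-- `√(-w) = i √w` for `w` in the lower half-plane. [folklore] -/
theorem csqrt_neg_of_im_neg {w : ℂ} (hw : w.im < 0) :
    Complex.sqrt (-w) = I * Complex.sqrt w := by
  have h := csqrt_neg_of_im_pos (w := -w) (by simpa using hw)
  rw [neg_neg] at h
  rw [h, ← mul_assoc, show I * -I = 1 by rw [mul_neg, I_mul_I, neg_neg], one_mul]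

/-- `√(ab) = √a √b` when `a` and `b` have positive real part (no branch crossing). [folklore] -/
theorem csqrt_mul_of_re_pos {a b : ℂ} (ha : 0 < a.re) (hb : 0 < b.re) :
    Complex.sqrt (a * b) = Complex.sqrt a * Complex.sqrt b := by
  -- `√a = x₁ + iy₁` with `x₁ > |y₁|` since `Re (√a)² = x₁² - y₁² = Re a > 0` and `x₁ ≥ 0`.
  have key : ∀ {c : ℂ}, 0 < c.re → |(Complex.sqrt c).im| < (Complex.sqrt c).re := by
    intro c hc
    have h1 : (Complex.sqrt c ^ 2).re = c.re := by rw [csqrt_sq]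
    rw [sq, Complex.mul_re] at h1
    have hx := csqrt_re_nonneg c
    have h2 : (Complex.sqrt c).im ^ 2 < (Complex.sqrt c).re ^ 2 := by nlinarith
    exact abs_lt_of_sq_lt_sq h2 hx
  apply csqrt_eq_of_sq_eq'
  · rw [mul_pow, csqrt_sq, csqrt_sq]
  · left
    rw [Complex.mul_re]
    have h1 := key ha
    have h2 := key hb
    have h3 : (Complex.sqrt a).im * (Complex.sqrt b).im ≤
        |(Complex.sqrt a).im| * |(Complex.sqrt b).im| := by
      rw [← abs_mul]; exact le_abs_self _
    have h4 : |(Complex.sqrt a).im| * |(Complex.sqrt b).im| <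
        (Complex.sqrt a).re * (Complex.sqrt b).re :=
      mul_lt_mul'' h1 h2 (abs_nonneg _) (abs_nonneg _)
    linarith

/-- **Branch relation for the step `W`**: for `u` in the upper half-plane and `X ≠ 0` with
`Im X ≥ 0`, `√(X/u) · √u = √X`. [folklore] -/
theorem csqrt_div_mul_csqrt {X u : ℂ} (hu : 0 < u.im) (hX : X ≠ 0) (hXi : 0 ≤ X.im) :
    Complex.sqrt (X / u) * Complex.sqrt u = Complex.sqrt X := by
  have hu0 : u ≠ 0 := by rintro rfl; simp at hu
  have hsq : (Complex.sqrt (X / u) * Complex.sqrt u) ^ 2 = Complex.sqrt X ^ 2 := by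
    rw [mul_pow, csqrt_sq, csqrt_sq, csqrt_sq, div_mul_cancel₀ X hu0]
  rcases sq_eq_sq_iff_eq_or_eq_neg.mp hsq with h | h
  · exact h
  · exfalso
    -- `√u` is in the open first quadrant, `√X` in the closed first quadrant and nonzero
    have hq := csqrt_mem_quadrant hu
    have hXre := csqrt_re_nonneg X
    have hXim : 0 ≤ (Complex.sqrt X).im := by
      rw [Complex.sqrt, Complex.cpow_inv_two_im_eq_sqrt hXi]; exact Real.sqrt_nonneg _
    have hX0 : Complex.sqrt X ≠ 0 := by
      intro h0
      apply hX
      rw [← csqrt_sq X, h0]; ring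
    have hsu0 : Complex.sqrt u ≠ 0 := by
      intro h0; rw [h0] at hq; simp at hq
    -- `Re (√X · conj √u) > 0`
    have hpos : 0 < (Complex.sqrt X * (starRingEnd ℂ) (Complex.sqrt u)).re := by
      rw [Complex.mul_re, Complex.conj_re, Complex.conj_im]
      have h1 : 0 ≤ (Complex.sqrt X).re * (Complex.sqrt u).re := mul_nonneg hXre hq.1.le
      have h2 : 0 ≤ (Complex.sqrt X).im * (Complex.sqrt u).im := mul_nonneg hXim hq.2.le
      rcases hXre.eq_or_lt with h3 | h3
      · -- `Re √X = 0`, so `Im √X > 0`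
        have h4 : 0 < (Complex.sqrt X).im := by
          rcases hXim.eq_or_lt with h4 | h4
          · exact absurd (Complex.ext (by rw [Complex.zero_re]; exact h3.symm)
              (by rw [Complex.zero_im]; exact h4.symm)) hX0
          · exact h4
        nlinarith [mul_pos h4 hq.2]
      · nlinarith [mul_pos h3 hq.1]
    -- but `√(X/u) = -√X/√u` has nonnegative real part
    have hdiv : Complex.sqrt (X / u) = -(Complex.sqrt X / Complex.sqrt u) := by
      rw [← neg_div, eq_div_iff hsu0, h]
    have hre := csqrt_re_nonneg (X / u)
    rw [hdiv, Complex.neg_re, Complex.div_re] at hre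
    have hn : 0 < Complex.normSq (Complex.sqrt u) := Complex.normSq_pos.mpr hsu0
    rw [Complex.mul_re, Complex.conj_re, Complex.conj_im] at hpos
    have : (Complex.sqrt X).re * (Complex.sqrt u).re / Complex.normSq (Complex.sqrt u) +
        (Complex.sqrt X).im * (Complex.sqrt u).im / Complex.normSq (Complex.sqrt u) =
        ((Complex.sqrt X).re * (Complex.sqrt u).re - (Complex.sqrt X).im * -(Complex.sqrt u).im) /
          Complex.normSq (Complex.sqrt u) := by ring
    rw [this] at hre
    have := div_pos hpos hn
    linarith

/-! ### The matrix `W = (1 0; 4 1)` and `θ(z/(4z + 1)) = √(4z + 1) θ(z)` -/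

/-- `W = (1 0; 4 1) ∈ SL₂(ℤ)`; together with `T = (1 1; 0 1)` and `-1` it generates `Γ₀(4)`.
[folklore] -/
def W4 : SL(2, ℤ) := ⟨!![1, 0; 4, 1], by norm_num [Matrix.det_fin_two_of]⟩

/-- Entries of `W`. [folklore] -/
@[simp] theorem W4_apply_00 : W4 0 0 = 1 := rfl
/-- Entries of `W`. [folklore] -/
@[simp] theorem W4_apply_01 : W4 0 1 = 0 := rfl
/-- Entries of `W`. [folklore] -/
@[simp] theorem W4_apply_10 : W4 1 0 = 4 := rfl
/-- Entries of `W`. [folklore] -/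
@[simp] theorem W4_apply_11 : W4 1 1 = 1 := rfl

/-- `W ∈ Γ₀(4)`. [folklore] -/
theorem W4_mem_Gamma0 : W4 ∈ Gamma0 4 := by
  rw [Gamma0_mem, W4_apply_10]
  decide

/-- `W z = z/(4z + 1)`. [folklore] -/
theorem coe_W4_smul (z : ℍ) : ((W4 • z : ℍ) : ℂ) = (z : ℂ) / (4 * z + 1) := by
  rw [coe_specialLinearGroup_apply]
  simp

/-- `Re(-iτ) > 0` for `τ ∈ ℍ`. [folklore] -/
theorem neg_I_mul_re_pos (τ : ℍ) : 0 < (-I * (τ : ℂ)).re := by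
  simpa using τ.2

/-- **`θ` under `W = (1 0; 4 1)`**: `θ(z/(4z+1)) = √(4z + 1) θ(z)` (principal branch), from
`ϑ(-1/τ) = √(-iτ) ϑ(τ)` (Mathlib's `jacobiTheta_S_smul`) applied twice:
`2z/(4z+1) = S(-2 + S(2z))`, and `√(-iτ₂) √(-iτ) = √(4z+1)` since both radicands have positive
real part. [folklore] -/
theorem shimuraTheta_W4_smul (z : ℍ) :
    shimuraTheta (W4 • z) = Complex.sqrt (4 * (z : ℂ) + 1) * shimuraTheta z := by
  have hz : (z : ℂ) ≠ 0 := z.ne_zero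
  -- `τ = 2z`, `τ₂ = -2 + Sτ = -2 - 1/τ`
  let τ : ℍ := ⟨2 * (z : ℂ), by simpa using z.2⟩
  have hτ : (τ : ℂ) = 2 * (z : ℂ) := rfl
  have hτ0 : (τ : ℂ) ≠ 0 := τ.ne_zero
  let τ₂ : ℍ := (-2 : ℝ) +ᵥ (ModularGroup.S • τ)
  have hSτ : ((ModularGroup.S • τ : ℍ) : ℂ) = -(τ : ℂ)⁻¹ := by
    rw [modular_S_smul]; simp [inv_neg]
  have hτ₂ : (τ₂ : ℂ) = -2 - (τ : ℂ)⁻¹ := by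
    show (((-2 : ℝ) +ᵥ (ModularGroup.S • τ) : ℍ) : ℂ) = _
    rw [coe_vadd, hSτ]; push_cast; ring
  have hSτ₂ : ((ModularGroup.S • τ₂ : ℍ) : ℂ) = 2 * ((W4 • z : ℍ) : ℂ) := by
    rw [modular_S_smul, coe_W4_smul]
    show (-(τ₂ : ℂ))⁻¹ = _
    rw [hτ₂, hτ]
    have h4 : (4 : ℂ) * z + 1 ≠ 0 := by
      intro h
      have := congrArg Complex.im h
      simp at this
      exact absurd this (by have := z.2; positivity)
    have h2z : (2 : ℂ) * z ≠ 0 := mul_ne_zero two_ne_zero hz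
    rw [show -(-2 - (2 * (z : ℂ))⁻¹) = (4 * z + 1) / (2 * z) by field_simp; ring, inv_div,
      mul_div_assoc]
  -- the two applications of `ϑ(-1/τ) = √(-iτ) ϑ(τ)`
  have h1 : jacobiTheta (τ₂ : ℂ) = (-I * τ) ^ (1 / 2 : ℂ) * jacobiTheta τ := by
    rw [← jacobiTheta_S_smul τ]
    have : (τ₂ : ℂ) = -2 + ((ModularGroup.S • τ : ℍ) : ℂ) := by rw [hτ₂, hSτ]; ring
    rw [this, ← jacobiTheta_two_add (-2 + _)]
    congr 1; ring
  have h2 := jacobiTheta_S_smul τ₂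
  rw [hSτ₂, h1] at h2
  -- assemble
  unfold shimuraTheta
  rw [h2, ← hτ, ← mul_assoc]
  congr 1
  rw [show (1 / 2 : ℂ) = 2⁻¹ by norm_num]
  change Complex.sqrt (-I * τ₂) * Complex.sqrt (-I * τ) = _
  rw [← csqrt_mul_of_re_pos (neg_I_mul_re_pos τ₂) (neg_I_mul_re_pos τ), hτ₂, hτ]
  congr 1
  rw [show -I * (-2 - (2 * (z : ℂ))⁻¹) * (-I * (2 * z)) =
    I ^ 2 * ((-2 - (2 * (z : ℂ))⁻¹) * (2 * z)) by ring, I_sq]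
  field_simp
  ring

/-! ### Shimura's `ε_d`, the symbol `(c/d)` and the factor `j(γ, z)` -/

/-- **Shimura's `ε_d`** for odd `d`: `1` if `d ≡ 1 (mod 4)` and `i` if `d ≡ 3 (mod 4)`; negative
`d` are reduced modulo `4` too (`ε_{-1} = i`, `ε_{-3} = 1`), which is the convention making
`θ(γz) = ε_d⁻¹ (c/d) √(cz+d) θ(z)` hold for both `±γ`. [cite: Shimura1973HalfIntegral, §1] -/
def thetaEps (d : ℤ) : ℂ := if d % 4 = 3 then I else 1

/-- **Shimura's quadratic residue symbol `(c/d)`** for `d` odd (`gcd(c, d) = 1` in the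
applications): the Jacobi symbol `(c/|d|)`, multiplied by `-1` when both `c < 0` and `d < 0`;
in particular `(0/±1) = 1`. [cite: Shimura1973HalfIntegral, §1] -/
def shimuraSymbol (c d : ℤ) : ℤ := (if c < 0 ∧ d < 0 then -1 else 1) * J(c | d.natAbs)

/-- **The automorphy factor of weight `1/2`**, `j(γ, z) = ε_d⁻¹ (c/d) (cz + d)^{1/2}` for
`γ = (a b; c d) ∈ Γ₀(4)`, as a function of the bottom row `(c, d)`; `(cz+d)^{1/2}` is the
principal square root. By `shimuraTheta_smul_eq` it equals `θ(γz)/θ(z)`.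
[cite: Shimura1973HalfIntegral, §1] -/
def thetaFactor (c d : ℤ) (z : ℍ) : ℂ :=
  (thetaEps d)⁻¹ * (shimuraSymbol c d : ℂ) * Complex.sqrt ((c : ℂ) * z + d)

/-- `ε_d ≠ 0`. [folklore] -/
theorem thetaEps_ne_zero (d : ℤ) : thetaEps d ≠ 0 := by
  unfold thetaEps; split_ifs
  · exact I_ne_zero
  · exact one_ne_zero

/-- `ε_d` depends only on `d mod 4`. [folklore] -/
theorem thetaEps_eq_of_emod_eq {d d' : ℤ} (h : d % 4 = d' % 4) : thetaEps d = thetaEps d' := by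
  unfold thetaEps; rw [h]

/-- `ε_d⁴ = 1`, indeed `ε_d² = χ₋₄(d)`: `ε_d⁻¹ ^ 2 = 1` if `d ≡ 1`, `-1` if `d ≡ 3 (mod 4)`.
[folklore] -/
theorem thetaEps_inv_sq (d : ℤ) : (thetaEps d)⁻¹ ^ 2 = if d % 4 = 3 then -1 else 1 := by
  unfold thetaEps
  split_ifs
  · rw [inv_pow, I_sq, inv_neg, inv_one]
  · simp

/-- `(c/d) = (c/|d|)` when `c ≥ 0`. [folklore] -/
theorem shimuraSymbol_of_nonneg {c : ℤ} (hc : 0 ≤ c) (d : ℤ) :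
    shimuraSymbol c d = J(c | d.natAbs) := by
  unfold shimuraSymbol
  rw [if_neg (fun h ↦ absurd h.1 (not_lt.mpr hc)), one_mul]

/-- `(c/d) = (c/|d|)` when `d > 0`. [folklore] -/
theorem shimuraSymbol_of_pos_right (c : ℤ) {d : ℤ} (hd : 0 < d) :
    shimuraSymbol c d = J(c | d.natAbs) := by
  unfold shimuraSymbol
  rw [if_neg (fun h ↦ absurd h.2 (not_lt.mpr hd.le)), one_mul]

/-- For odd `m`, `χ₄(|m|) · (-1)^{[m < 0]} = χ₄(m)` (`χ₄` is odd). [folklore] -/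
theorem sign_mul_χ₄_natAbs (m : ℤ) :
    (if m < 0 then -1 else 1) * ZMod.χ₄ ((m.natAbs : ℕ) : ZMod 4) = ZMod.χ₄ (m : ZMod 4) := by
  have key : ∀ x : ZMod 4, ZMod.χ₄ (-x) = -ZMod.χ₄ x := by decide
  obtain ⟨n, rfl | rfl⟩ := Int.eq_nat_or_neg m
  · simp
  · rw [Int.natAbs_neg, Int.natAbs_natCast, Int.cast_neg, Int.cast_natCast, key]
    rcases Nat.eq_zero_or_pos n with rfl | hn
    · simp
    · rw [if_pos (by omega)]; ring

/-- `(c/d) = χ₄(d) (-c/|d|)` when `c < 0` (`d` odd): the sign convention makes the symbol a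
function of `d mod 4|c|`. [folklore] -/
theorem shimuraSymbol_of_neg {c : ℤ} (hc : c < 0) {d : ℤ} (hd : Odd d) :
    shimuraSymbol c d = ZMod.χ₄ (d : ZMod 4) * J(-c | d.natAbs) := by
  have hdn : Odd d.natAbs := Int.natAbs_odd.mpr hd
  unfold shimuraSymbol
  rw [if_congr (and_iff_right hc) rfl rfl, show J(c | d.natAbs) = J(-(-c) | d.natAbs) by
    rw [neg_neg], jacobiSym.neg _ hdn, ← sign_mul_χ₄_natAbs d]
  ring

/-- **`(c/d)` is unchanged under `d ↦ d + c` when `4 ∣ c`** (the step `γ ↦ γT`; Knopp, Ch. 4,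
proof of Thm. 2, case 1 (b), where the sign is `+` because `c ≢ 2 (mod 4)`). [folklore] -/
theorem shimuraSymbol_add_self {c d : ℤ} (hc : 4 ∣ c) (hd : Odd d) :
    shimuraSymbol c (d + c) = shimuraSymbol c d := by
  rcases lt_trichotomy c 0 with hlt | rfl | hgt
  · -- `c < 0`: `(c/d) = χ₄(d) (|c| / |d|)`
    have hd' : Odd (d + c) := by
      obtain ⟨k, rfl⟩ := hc
      exact hd.add_even ⟨2 * k, by ring⟩
    rw [shimuraSymbol_of_neg hlt hd', shimuraSymbol_of_neg hlt hd]
    obtain ⟨n, hn⟩ : ∃ n : ℕ, -c = n := ⟨(-c).toNat, (Int.toNat_of_nonneg (by omega)).symm⟩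
    have hn0 : n ≠ 0 := by omega
    have hne : Even n := by
      have : Even (-c) := by obtain ⟨k, rfl⟩ := hc; exact ⟨-(2 * k), by ring⟩
      rw [hn] at this; exact_mod_cast this
    have hshift := jacobiSym_even_shift hn0 hne (d := d + c) hd'
    rw [if_neg (by omega), one_mul, show d + c + (n : ℤ) = d by omega] at hshift
    rw [hn, ← hshift]
    congr 1
    rw [ZMod.χ₄_int_mod_four, ZMod.χ₄_int_mod_four d]
    congr 2
    obtain ⟨k, rfl⟩ := hc
    omega
  · simp
  · -- `c > 0`
    have hd' : Odd (d + c) := by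
      obtain ⟨k, rfl⟩ := hc
      exact hd.add_even ⟨2 * k, by ring⟩
    rw [shimuraSymbol_of_nonneg hgt.le, shimuraSymbol_of_nonneg hgt.le]
    obtain ⟨n, hn⟩ : ∃ n : ℕ, c = n := ⟨c.toNat, (Int.toNat_of_nonneg hgt.le).symm⟩
    have hn0 : n ≠ 0 := by omega
    have hne : Even n := by
      have : Even c := by obtain ⟨k, rfl⟩ := hc; exact ⟨2 * k, by ring⟩
      rw [hn] at this; exact_mod_cast this
    have hshift := jacobiSym_even_shift hn0 hne hd
    rw [if_neg (by omega), one_mul] at hshift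
    rw [hn, hshift]

/-- `(c/d)` is unchanged under `d ↦ d - c` when `4 ∣ c` (the step `γ ↦ γT⁻¹`). [folklore] -/
theorem shimuraSymbol_sub_self {c d : ℤ} (hc : 4 ∣ c) (hd : Odd d) :
    shimuraSymbol c (d - c) = shimuraSymbol c d := by
  have hd' : Odd (d - c) := by
    obtain ⟨k, rfl⟩ := hc
    exact hd.sub_even ⟨2 * k, by ring⟩
  have := shimuraSymbol_add_self hc hd'
  rw [sub_add_cancel] at this
  exact this.symm

/-- `(c'/d) = (c/d)` when `c' ≡ c (mod d)` and neither pair has both entries negative (the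
step `γ ↦ γW^{±1}`, `c' = c ± 4d`). [folklore] -/
theorem shimuraSymbol_eq_of_emod_eq {c c' d : ℤ} (h : c' % d = c % d) (hs : ¬ (c < 0 ∧ d < 0))
    (hs' : ¬ (c' < 0 ∧ d < 0)) : shimuraSymbol c' d = shimuraSymbol c d := by
  unfold shimuraSymbol
  rw [if_neg hs, if_neg hs', one_mul, one_mul]
  apply jacobiSym.mod_left'
  rw [Int.natCast_natAbs]
  rcases le_or_gt 0 d with hd | hd
  · rw [abs_of_nonneg hd, h]
  · rw [abs_of_neg hd, Int.emod_neg, Int.emod_neg, h]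

/-- **Sign invariance**: `ε_{-d}⁻¹ ((-c) / (-d)) √(-cz - d) = ε_d⁻¹ (c/d) √(cz + d)` for `d` odd
(and `d = ±1` if `c = 0`), so the transformation law is the same for `γ` and `-γ`.
[cite: Shimura1973HalfIntegral, §1] -/
theorem thetaFactor_neg {c d : ℤ} (hd : Odd d) (hcd : c = 0 → d = 1 ∨ d = -1) (z : ℍ) :
    thetaFactor (-c) (-d) z = thetaFactor c d z := by
  -- the case `c > 0`, for all odd `d`
  have main : ∀ {c d : ℤ}, 0 < c → Odd d → thetaFactor (-c) (-d) z = thetaFactor c d z := by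
    intro c d hc hd
    have hdn : Odd d.natAbs := Int.natAbs_odd.mpr hd
    have hd2 : d % 2 = 1 := Int.odd_iff.mp hd
    have him : 0 < ((c : ℂ) * z + d).im := by simpa using mul_pos (Int.cast_pos.mpr hc) z.2
    unfold thetaFactor
    rw [show ((-c : ℤ) : ℂ) * z + ((-d : ℤ) : ℂ) = -((c : ℂ) * z + d) by push_cast; ring,
      csqrt_neg_of_im_pos him, shimuraSymbol_of_nonneg hc.le]
    unfold shimuraSymbol
    rw [if_congr (and_iff_right (neg_neg_of_pos hc)) rfl rfl, Int.natAbs_neg, jacobiSym.neg _ hdn]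
    -- now a finite computation on `d mod 4` and the sign of `d`
    have h4 : d % 4 = 1 ∨ d % 4 = 3 := by omega
    unfold thetaEps
    rcases h4 with h4 | h4 <;> rcases lt_or_gt_of_ne (show d ≠ 0 by rintro rfl; simp at hd2)
      with hneg | hpos
    · have hna : ((d.natAbs : ℕ) : ZMod 4) = ((-d : ℤ) : ZMod 4) := by
        rw [← Int.cast_natCast, Int.natCast_natAbs, abs_of_neg hneg]
      rw [if_pos (show (-d) % 4 = 3 by omega), if_neg (show ¬ d % 4 = 3 by omega),
        if_neg (show ¬ (-d < 0) by omega), hna, ZMod.χ₄_int_eq_if_mod_four,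
        if_neg (show ¬ (-d) % 2 = 0 by omega), if_neg (show ¬ (-d) % 4 = 1 by omega)]
      push_cast
      simp only [inv_I, inv_one]
      linear_combination (-(J(c | d.natAbs) : ℂ) * Complex.sqrt (c * z + d)) * I_sq
    · have hna : ((d.natAbs : ℕ) : ZMod 4) = ((d : ℤ) : ZMod 4) := by
        rw [← Int.cast_natCast, Int.natCast_natAbs, abs_of_pos hpos]
      rw [if_pos (show (-d) % 4 = 3 by omega), if_neg (show ¬ d % 4 = 3 by omega),
        if_pos (show -d < 0 by omega), hna, ZMod.χ₄_int_eq_if_mod_four,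
        if_neg (show ¬ d % 2 = 0 by omega), if_pos h4]
      push_cast
      simp only [inv_I, inv_one]
      linear_combination (-(J(c | d.natAbs) : ℂ) * Complex.sqrt (c * z + d)) * I_sq
    · have hna : ((d.natAbs : ℕ) : ZMod 4) = ((-d : ℤ) : ZMod 4) := by
        rw [← Int.cast_natCast, Int.natCast_natAbs, abs_of_neg hneg]
      rw [if_neg (show ¬ (-d) % 4 = 3 by omega), if_pos h4,
        if_neg (show ¬ (-d < 0) by omega), hna, ZMod.χ₄_int_eq_if_mod_four,
        if_neg (show ¬ (-d) % 2 = 0 by omega), if_pos (show (-d) % 4 = 1 by omega)]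
      push_cast
      simp only [inv_I, inv_one]
      ring
    · have hna : ((d.natAbs : ℕ) : ZMod 4) = ((d : ℤ) : ZMod 4) := by
        rw [← Int.cast_natCast, Int.natCast_natAbs, abs_of_pos hpos]
      rw [if_neg (show ¬ (-d) % 4 = 3 by omega), if_pos h4,
        if_pos (show -d < 0 by omega), hna, ZMod.χ₄_int_eq_if_mod_four,
        if_neg (show ¬ d % 2 = 0 by omega), if_neg (show ¬ d % 4 = 1 by omega)]
      push_cast
      simp only [inv_I, inv_one]
      ring
  rcases lt_trichotomy c 0 with hlt | rfl | hgt
  · have := main (c := -c) (d := -d) (by omega) hd.neg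
    rw [neg_neg, neg_neg] at this
    exact this.symm
  · -- `c = 0`, `d = ±1`
    unfold thetaFactor shimuraSymbol thetaEps
    rcases hcd rfl with rfl | rfl
    · norm_num [Complex.sqrt_neg_one]
    · norm_num [Complex.sqrt_neg_one]
  · exact main hgt hd

/-! ### The law at one matrix and the steps `γ ↦ -γ`, `γ ↦ γT^{±1}`, `γ ↦ γW^{±1}` -/

/-- The transformation law at a single matrix, as a proposition: for all `z ∈ ℍ`,
`θ(γz) = ε_d⁻¹ (c/d) √(cz + d) θ(z)`. [folklore] -/
def ThetaTransfAt (γ : SL(2, ℤ)) : Prop :=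
  ∀ z : ℍ, shimuraTheta (γ • z) = thetaFactor (γ 1 0) (γ 1 1) z * shimuraTheta z

/-- `4 ∣ c` for `γ ∈ Γ₀(4)`. [folklore] -/
theorem four_dvd_c_of_mem_Gamma0 {γ : SL(2, ℤ)} (hγ : γ ∈ Gamma0 4) : (4 : ℤ) ∣ γ 1 0 := by
  rw [Gamma0_mem] at hγ
  exact_mod_cast (ZMod.intCast_zmod_eq_zero_iff_dvd _ 4).mp hγ

/-- `d` is odd for `γ ∈ Γ₀(4)`. [folklore] -/
theorem odd_d_of_mem_Gamma0 {γ : SL(2, ℤ)} (hγ : γ ∈ Gamma0 4) : Odd (γ 1 1) := by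
  have hdet := det_entries γ
  obtain ⟨k, hk⟩ := four_dvd_c_of_mem_Gamma0 hγ
  by_contra h
  rw [Int.not_odd_iff_even] at h
  obtain ⟨m, hm⟩ := h
  have h2 : (2 : ℤ) ∣ γ 0 0 * γ 1 1 - γ 0 1 * γ 1 0 :=
    ⟨γ 0 0 * m - γ 0 1 * (2 * k), by rw [hm, hk]; ring⟩
  rw [hdet] at h2
  norm_num at h2

/-- `Γ₀(4)` is closed under `γ ↦ -γ`. [folklore] -/
theorem neg_mem_Gamma0 {N : ℕ} {γ : SL(2, ℤ)} (hγ : γ ∈ Gamma0 N) : -γ ∈ Gamma0 N := by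
  rw [Gamma0_mem] at hγ ⊢
  rw [SL_neg_apply, Int.cast_neg, hγ, neg_zero]

/-- **Step `-1`**: the law for `γ` is equivalent to the law for `-γ`. [folklore] -/
theorem thetaTransfAt_neg_iff {γ : SL(2, ℤ)} (hγ : γ ∈ Gamma0 4) :
    ThetaTransfAt (-γ) ↔ ThetaTransfAt γ := by
  unfold ThetaTransfAt
  have h : ∀ z, thetaFactor ((-γ) 1 0) ((-γ) 1 1) z = thetaFactor (γ 1 0) (γ 1 1) z := fun z ↦ by
    rw [SL_neg_apply, SL_neg_apply]
    exact thetaFactor_neg (odd_d_of_mem_Gamma0 hγ) (SL2Z_d_of_c_eq_zero γ) z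
  simp_rw [h, ModularGroup.SL_neg_smul]

/-- `θ(z + m) = θ(z)` for `m ∈ ℤ`. [folklore] -/
theorem shimuraTheta_T_zpow_smul (m : ℤ) (z : ℍ) :
    shimuraTheta (ModularGroup.T ^ m • z) = shimuraTheta z := by
  induction m using Int.induction_on generalizing z with
  | zero => simp
  | succ n ih => rw [zpow_add_one, mul_smul, ih, shimuraTheta_T_smul]
  | pred n ih =>
    rw [zpow_sub_one, mul_smul, ih]
    have := shimuraTheta_T_smul (ModularGroup.T⁻¹ • z)
    rw [smul_inv_smul] at this
    exact this.symm

/-- **Base case `c = 0`**: `γ = ±Tᵇ`, `θ(z ± b) = θ(z)` and `ε_{±1}⁻¹ (0/±1) √(±1) = 1`.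
[folklore] -/
theorem thetaTransfAt_of_c_eq_zero {γ : SL(2, ℤ)} (hc : γ 1 0 = 0) : ThetaTransfAt γ := by
  intro z
  have hdet := det_entries γ
  rw [hc, mul_zero, sub_zero] at hdet
  rcases SL2Z_d_of_c_eq_zero γ hc with hd | hd
  · have ha : γ 0 0 = 1 := by rw [hd, mul_one] at hdet; exact hdet
    have hsm : γ • z = ModularGroup.T ^ (γ 0 1) • z := by
      apply UpperHalfPlane.ext
      rw [coe_specialLinearGroup_apply, modular_T_zpow_smul, coe_vadd]
      simp [ha, hc, hd]
      ring
    rw [hsm, shimuraTheta_T_zpow_smul, hc, hd]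
    unfold thetaFactor thetaEps shimuraSymbol
    norm_num
  · have ha : γ 0 0 = -1 := by rw [hd] at hdet; linarith
    have hsm : γ • z = ModularGroup.T ^ (-(γ 0 1)) • z := by
      apply UpperHalfPlane.ext
      rw [coe_specialLinearGroup_apply, modular_T_zpow_smul, coe_vadd]
      simp [ha, hc, hd]
      ring
    rw [hsm, shimuraTheta_T_zpow_smul, hc, hd]
    unfold thetaFactor thetaEps shimuraSymbol
    norm_num [Complex.sqrt_neg_one]

/-- **Step `T`**: the law for `γ ∈ Γ₀(4)` implies the law for `γT = (a, a + b; c, c + d)`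
(`ε_{c+d} = ε_d`, `(c/c + d) = (c/d)`, `√(c(z + 1) + d) = √(cz + (c + d))`). [folklore] -/
theorem thetaTransfAt_mul_T {γ : SL(2, ℤ)} (hγ : γ ∈ Gamma0 4) (h : ThetaTransfAt γ) :
    ThetaTransfAt (γ * ModularGroup.T) := by
  intro z
  obtain ⟨-, -, h10, h11⟩ := coe_mul_T γ
  have h4 := four_dvd_c_of_mem_Gamma0 hγ
  have hd := odd_d_of_mem_Gamma0 hγ
  rw [h10, h11, mul_smul, h (ModularGroup.T • z), shimuraTheta_T_smul]
  congr 1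
  unfold thetaFactor
  rw [thetaEps_eq_of_emod_eq (d := γ 1 0 + γ 1 1) (d' := γ 1 1) (by obtain ⟨k, hk⟩ := h4; omega),
    add_comm (γ 1 0) (γ 1 1), shimuraSymbol_add_self h4 hd]
  congr 2
  rw [modular_T_smul, coe_vadd]
  push_cast
  ring

/-- **Step `T⁻¹`**: the law for `γ ∈ Γ₀(4)` implies the law for `γT⁻¹ = (a, b - a; c, d - c)`.
[folklore] -/
theorem thetaTransfAt_mul_T_inv {γ : SL(2, ℤ)} (hγ : γ ∈ Gamma0 4) (h : ThetaTransfAt γ) :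
    ThetaTransfAt (γ * ModularGroup.T⁻¹) := by
  intro z
  obtain ⟨-, -, h10, h11⟩ := coe_mul_T_inv γ
  have h4 := four_dvd_c_of_mem_Gamma0 hγ
  have hd := odd_d_of_mem_Gamma0 hγ
  have hT : shimuraTheta (ModularGroup.T⁻¹ • z) = shimuraTheta z := by
    simpa using shimuraTheta_T_zpow_smul (-1) z
  have hTc : ((ModularGroup.T⁻¹ • z : ℍ) : ℂ) = (z : ℂ) - 1 := by
    have := modular_T_zpow_smul z (-1)
    simp only [zpow_neg, zpow_one] at this
    rw [this, coe_vadd]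
    push_cast
    ring
  rw [h10, h11, mul_smul, h (ModularGroup.T⁻¹ • z), hT]
  congr 1
  unfold thetaFactor
  rw [thetaEps_eq_of_emod_eq (d := γ 1 1 - γ 1 0) (d' := γ 1 1) (by obtain ⟨k, hk⟩ := h4; omega),
    shimuraSymbol_sub_self h4 hd]
  congr 2
  rw [hTc]
  push_cast
  ring

/-- Entries of `γW`. [folklore] -/
theorem coe_mul_W4 (γ : SL(2, ℤ)) :
    (γ * W4) 0 0 = γ 0 0 + 4 * γ 0 1 ∧ (γ * W4) 0 1 = γ 0 1 ∧
      (γ * W4) 1 0 = γ 1 0 + 4 * γ 1 1 ∧ (γ * W4) 1 1 = γ 1 1 := by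
  refine ⟨?_, ?_, ?_, ?_⟩ <;>
  · simp [Matrix.mul_apply, Fin.sum_univ_two]
    try ring

/-- Entries of `W⁻¹ = (1 0; -4 1)`. [folklore] -/
theorem coe_W4_inv : (W4⁻¹ : SL(2, ℤ)) 0 0 = 1 ∧ (W4⁻¹ : SL(2, ℤ)) 0 1 = 0 ∧
    (W4⁻¹ : SL(2, ℤ)) 1 0 = -4 ∧ (W4⁻¹ : SL(2, ℤ)) 1 1 = 1 := by
  simp [Matrix.SpecialLinearGroup.coe_inv, Matrix.adjugate_fin_two]

/-- Entries of `γW⁻¹`. [folklore] -/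
theorem coe_mul_W4_inv (γ : SL(2, ℤ)) :
    (γ * W4⁻¹) 0 0 = γ 0 0 - 4 * γ 0 1 ∧ (γ * W4⁻¹) 0 1 = γ 0 1 ∧
      (γ * W4⁻¹) 1 0 = γ 1 0 - 4 * γ 1 1 ∧ (γ * W4⁻¹) 1 1 = γ 1 1 := by
  obtain ⟨i00, i01, i10, i11⟩ := coe_W4_inv
  refine ⟨?_, ?_, ?_, ?_⟩ <;>
  · simp only [Matrix.SpecialLinearGroup.coe_mul, Matrix.mul_apply, Fin.sum_univ_two, i00, i01,
      i10, i11]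
    ring

/-- The radicand `c'z + d` for `c' ≥ 0` and `d` odd is nonzero with `Im ≥ 0`. [folklore] -/
theorem radicand_ne_zero_im_nonneg {c' d : ℤ} (hc' : 0 ≤ c') (hd : Odd d) (z : ℍ) :
    (c' : ℂ) * z + d ≠ 0 ∧ 0 ≤ ((c' : ℂ) * z + d).im := by
  have him : ((c' : ℂ) * z + d).im = (c' : ℝ) * z.im := by simp [Complex.add_im, Complex.mul_im]
  refine ⟨fun h0 ↦ ?_, by rw [him]; exact mul_nonneg (by exact_mod_cast hc') z.2.le⟩
  rcases hc'.eq_or_lt with rfl | hlt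
  · simp only [Int.cast_zero, zero_mul, zero_add, Int.cast_eq_zero] at h0
    rw [h0] at hd
    exact (Int.not_odd_iff_even.mpr Even.zero) hd
  · have := congrArg Complex.im h0
    rw [him, Complex.zero_im] at this
    exact (mul_pos (by exact_mod_cast hlt) z.2).ne' this

/-- **Step `W`, case of a non-negative new `c`**: the law for `γ ∈ Γ₀(4)` with `c + 4d ≥ 0`
implies the law for `γW = (a + 4b, b; c + 4d, d)`: `(c + 4d / d) = (c/d)` and
`√((c'z + d)/(4z + 1)) √(4z + 1) = √(c'z + d)`. [folklore] -/
theorem thetaTransfAt_mul_W4_of_nonneg {γ : SL(2, ℤ)} (hγ : γ ∈ Gamma0 4) (h : ThetaTransfAt γ)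
    (hc' : 0 ≤ γ 1 0 + 4 * γ 1 1) : ThetaTransfAt (γ * W4) := by
  intro z
  obtain ⟨-, -, h10, h11⟩ := coe_mul_W4 γ
  have hd := odd_d_of_mem_Gamma0 hγ
  rw [h10, h11, mul_smul, h (W4 • z), shimuraTheta_W4_smul, ← mul_assoc]
  congr 1
  unfold thetaFactor
  rw [shimuraSymbol_eq_of_emod_eq (c := γ 1 0) (c' := γ 1 0 + 4 * γ 1 1) (d := γ 1 1)
    (by rw [show (4 : ℤ) * γ 1 1 = (4 : ℤ) * 1 * γ 1 1 by ring, Int.add_mul_emod_self_right])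
    (by omega) (by omega), mul_assoc]
  congr 1
  obtain ⟨hX0, hXi⟩ := radicand_ne_zero_im_nonneg hc' hd z
  have hu : 0 < ((4 : ℂ) * z + 1).im := by simpa using z.2
  have hu0 : (4 : ℂ) * z + 1 ≠ 0 := by
    intro h0; rw [h0] at hu; simp at hu
  rw [coe_W4_smul, show (γ 1 0 : ℂ) * ((z : ℂ) / (4 * z + 1)) + (γ 1 1 : ℂ) =
    (((γ 1 0 + 4 * γ 1 1 : ℤ) : ℂ) * z + (γ 1 1 : ℂ)) / (4 * z + 1) by
      rw [eq_div_iff hu0, add_mul, mul_div_assoc', div_mul_cancel₀ _ hu0]; push_cast; ring]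
  exact csqrt_div_mul_csqrt hu hX0 hXi

/-- **Step `W⁻¹`, case `c ≥ 0`**: the law for `γ ∈ Γ₀(4)` with `c ≥ 0` implies the law for
`γW⁻¹ = (a - 4b, b; c - 4d, d)` (write `z = Ww` and use `θ(Ww) = √(4w + 1) θ(w)`). [folklore] -/
theorem thetaTransfAt_mul_W4_inv_of_nonneg {γ : SL(2, ℤ)} (hγ : γ ∈ Gamma0 4)
    (h : ThetaTransfAt γ) (hc : 0 ≤ γ 1 0) : ThetaTransfAt (γ * W4⁻¹) := by
  intro z
  obtain ⟨w, rfl⟩ : ∃ w : ℍ, z = W4 • w := ⟨W4⁻¹ • z, by rw [smul_inv_smul]⟩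
  obtain ⟨-, -, h10, h11⟩ := coe_mul_W4_inv γ
  have hd := odd_d_of_mem_Gamma0 hγ
  rw [h10, h11, mul_smul, inv_smul_smul, h w, shimuraTheta_W4_smul, ← mul_assoc]
  congr 1
  symm
  unfold thetaFactor
  rw [shimuraSymbol_eq_of_emod_eq (c := γ 1 0) (c' := γ 1 0 - 4 * γ 1 1) (d := γ 1 1)
    (by rw [show γ 1 0 - (4 : ℤ) * γ 1 1 = γ 1 0 + (-4 : ℤ) * γ 1 1 by ring,
      Int.add_mul_emod_self_right]) (by omega) (by omega), mul_assoc]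
  congr 1
  obtain ⟨hX0, hXi⟩ := radicand_ne_zero_im_nonneg hc hd w
  have hu : 0 < ((4 : ℂ) * w + 1).im := by simpa using w.2
  have hu0 : (4 : ℂ) * w + 1 ≠ 0 := by
    intro h0; rw [h0] at hu; simp at hu
  rw [coe_W4_smul, show ((γ 1 0 - 4 * γ 1 1 : ℤ) : ℂ) * ((w : ℂ) / (4 * w + 1)) + (γ 1 1 : ℂ) =
    ((γ 1 0 : ℂ) * w + (γ 1 1 : ℂ)) / (4 * w + 1) by
      rw [eq_div_iff hu0, add_mul, mul_div_assoc', div_mul_cancel₀ _ hu0]; push_cast; ring]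
  exact csqrt_div_mul_csqrt hu hX0 hXi

/-- **Step `W`** in general (reduce to a non-negative new `c` with `γ ↦ -γ`). [folklore] -/
theorem thetaTransfAt_mul_W4 {γ : SL(2, ℤ)} (hγ : γ ∈ Gamma0 4) (h : ThetaTransfAt γ) :
    ThetaTransfAt (γ * W4) := by
  rcases le_or_gt 0 (γ 1 0 + 4 * γ 1 1) with hc' | hc'
  · exact thetaTransfAt_mul_W4_of_nonneg hγ h hc'
  · have hγ' := neg_mem_Gamma0 hγ
    have h' := (thetaTransfAt_neg_iff hγ).mpr h
    have := thetaTransfAt_mul_W4_of_nonneg hγ' h' (by rw [SL_neg_apply, SL_neg_apply]; omega)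
    rw [neg_mul] at this
    exact (thetaTransfAt_neg_iff (mul_mem hγ W4_mem_Gamma0)).mp this

/-- **Step `W⁻¹`** in general. [folklore] -/
theorem thetaTransfAt_mul_W4_inv {γ : SL(2, ℤ)} (hγ : γ ∈ Gamma0 4) (h : ThetaTransfAt γ) :
    ThetaTransfAt (γ * W4⁻¹) := by
  rcases le_or_gt 0 (γ 1 0) with hc | hc
  · exact thetaTransfAt_mul_W4_inv_of_nonneg hγ h hc
  · have hγ' := neg_mem_Gamma0 hγ
    have h' := (thetaTransfAt_neg_iff hγ).mpr h
    have := thetaTransfAt_mul_W4_inv_of_nonneg hγ' h' (by rw [SL_neg_apply]; omega)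
    rw [neg_mul] at this
    exact (thetaTransfAt_neg_iff (mul_mem hγ (inv_mem W4_mem_Gamma0))).mp this

/-- Iterating the steps `T^{±1}`. [folklore] -/
theorem thetaTransfAt_mul_T_zpow {γ : SL(2, ℤ)} (hγ : γ ∈ Gamma0 4) (h : ThetaTransfAt γ)
    (n : ℤ) : ThetaTransfAt (γ * ModularGroup.T ^ n) := by
  have hT : ModularGroup.T ∈ Gamma0 4 := modularT_mem_Gamma0 4
  induction n using Int.induction_on with
  | zero => simpa using h
  | succ n ih =>
    rw [zpow_add_one, ← mul_assoc]
    exact thetaTransfAt_mul_T (mul_mem hγ (zpow_mem hT _)) ih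
  | pred n ih =>
    rw [zpow_sub_one, ← mul_assoc]
    exact thetaTransfAt_mul_T_inv (mul_mem hγ (zpow_mem hT _)) ih

/-- Iterating the steps `W^{±1}`. [folklore] -/
theorem thetaTransfAt_mul_W4_zpow {γ : SL(2, ℤ)} (hγ : γ ∈ Gamma0 4) (h : ThetaTransfAt γ)
    (m : ℤ) : ThetaTransfAt (γ * W4 ^ m) := by
  induction m using Int.induction_on with
  | zero => simpa using h
  | succ n ih =>
    rw [zpow_add_one, ← mul_assoc]
    exact thetaTransfAt_mul_W4 (mul_mem hγ (zpow_mem W4_mem_Gamma0 _)) ih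
  | pred n ih =>
    rw [zpow_sub_one, ← mul_assoc]
    exact thetaTransfAt_mul_W4_inv (mul_mem hγ (zpow_mem W4_mem_Gamma0 _)) ih

/-! ### The descent `γ ↦ γ Tⁿ Wᵐ` and the induction on `|c|` -/

/-- Entries of `Wᵐ = (1 0; 4m 1)`. [folklore] -/
theorem coe_W4_zpow (m : ℤ) : (W4 ^ m : SL(2, ℤ)) 0 0 = 1 ∧ (W4 ^ m : SL(2, ℤ)) 0 1 = 0 ∧
    (W4 ^ m : SL(2, ℤ)) 1 0 = 4 * m ∧ (W4 ^ m : SL(2, ℤ)) 1 1 = 1 := by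
  induction m using Int.induction_on with
  | zero => simp
  | succ n ih =>
    obtain ⟨h00, h01, h10, h11⟩ := ih
    obtain ⟨e00, e01, e10, e11⟩ := coe_mul_W4 (W4 ^ (n : ℤ))
    rw [zpow_add_one, e00, e01, e10, e11, h00, h01, h10, h11]
    refine ⟨by ring, rfl, by ring, rfl⟩
  | pred n ih =>
    obtain ⟨h00, h01, h10, h11⟩ := ih
    obtain ⟨e00, e01, e10, e11⟩ := coe_mul_W4_inv (W4 ^ (-(n : ℤ)))
    rw [zpow_sub_one, e00, e01, e10, e11, h00, h01, h10, h11]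
    refine ⟨by ring, rfl, by ring, rfl⟩

/-- **The arithmetic of the descent**: for `c ≠ 0` with `4 ∣ c` and `d` odd there are
`n, m ∈ ℤ` with `|c + 4m(cn + d)| < |c|` (choose `|cn + d| < |c|/2`, possible since `cn + d`
is odd and `c/2` even, then `|c + 4m d₁| ≤ 2|d₁|`). [folklore] -/
theorem descent_arith {c d : ℤ} (hc : c ≠ 0) (h4 : 4 ∣ c) (hd : d % 2 = 1) :
    ∃ n m : ℤ, |c + 4 * m * (c * n + d)| < |c| := by
  obtain ⟨C, hC⟩ : ∃ C, C = |c| := ⟨_, rfl⟩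
  have hC0 : 0 < C := hC ▸ abs_pos.mpr hc
  have hCc : C = c ∨ C = -c := hC ▸ abs_choice c
  have h4C : 4 ∣ C := hC ▸ (dvd_abs 4 c).mpr h4
  rw [← hC]
  -- Step 1: `d₁ = cn + d` with `-C < 2d₁ < C`
  obtain ⟨n, d₁, hd₁, hlo, hhi, hodd⟩ :
      ∃ n d₁ : ℤ, d₁ = c * n + d ∧ -C < 2 * d₁ ∧ 2 * d₁ < C ∧ d₁ % 2 = 1 := by
    have hr0 : 0 ≤ (d + C / 2) % C := Int.emod_nonneg _ hC0.ne'
    have hrC : (d + C / 2) % C < C := Int.emod_lt_of_pos _ hC0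
    have hqr : C * ((d + C / 2) / C) + (d + C / 2) % C = d + C / 2 := Int.mul_ediv_add_emod _ _
    obtain ⟨P, hP⟩ : ∃ P, P = C * ((d + C / 2) / C) := ⟨_, rfl⟩
    obtain ⟨r, hr⟩ : ∃ r, r = (d + C / 2) % C := ⟨_, rfl⟩
    rw [← hP, ← hr] at hqr
    rw [← hr] at hr0 hrC
    obtain ⟨n, hn⟩ : ∃ n : ℤ, c * n = -P := by
      rcases hCc with h | h
      · exact ⟨-((d + C / 2) / C), by rw [hP, h]; ring⟩
      · exact ⟨(d + C / 2) / C, by rw [hP, h]; ring⟩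
    have h2cn : 2 ∣ c * n := Dvd.dvd.mul_right (dvd_trans ⟨2, by norm_num⟩ h4) n
    refine ⟨n, c * n + d, rfl, ?_, ?_, ?_⟩ <;> omega
  -- Step 2: `c₂ = c + 4 m d₁` with `|c₂| ≤ 2|d₁| < C`
  have hd₁0 : d₁ ≠ 0 := by rintro rfl; simp at hodd
  obtain ⟨D, hD⟩ : ∃ D, D = |d₁| := ⟨_, rfl⟩
  have hD0 : 0 < D := hD ▸ abs_pos.mpr hd₁0
  have hDd : D = d₁ ∨ D = -d₁ := hD ▸ abs_choice d₁
  have h2D : 2 * D < C := by rcases hDd with h | h <;> omega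
  have h4D0 : 0 < 4 * D := by omega
  have hr0 : 0 ≤ (c + 2 * D) % (4 * D) := Int.emod_nonneg _ h4D0.ne'
  have hr4D : (c + 2 * D) % (4 * D) < 4 * D := Int.emod_lt_of_pos _ h4D0
  have hqr : 4 * D * ((c + 2 * D) / (4 * D)) + (c + 2 * D) % (4 * D) = c + 2 * D :=
    Int.mul_ediv_add_emod _ _
  obtain ⟨Q, hQ⟩ : ∃ Q, Q = D * ((c + 2 * D) / (4 * D)) := ⟨_, rfl⟩
  obtain ⟨r', hr'⟩ : ∃ r', r' = (c + 2 * D) % (4 * D) := ⟨_, rfl⟩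
  have hqr' : 4 * Q + r' = c + 2 * D := by rw [hQ, hr']; linear_combination hqr
  rw [← hr'] at hr0 hr4D
  obtain ⟨m, hm⟩ : ∃ m : ℤ, m * d₁ = -Q := by
    rcases hDd with h | h
    · exact ⟨-((c + 2 * D) / (4 * D)), by rw [hQ, h]; ring⟩
    · exact ⟨(c + 2 * D) / (4 * D), by rw [hQ, h]; ring⟩
  refine ⟨n, m, ?_⟩
  rw [← hd₁, show c + 4 * m * d₁ = c + 4 * (m * d₁) by ring, hm, abs_lt]
  constructor <;> omega

/-- **Descent**: for `γ ∈ Γ₀(4)` with `c ≠ 0` there are `n, m ∈ ℤ` with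
`|c(γ Tⁿ Wᵐ)| < |c(γ)|`. [folklore] -/
theorem exists_descent {γ : SL(2, ℤ)} (hγ : γ ∈ Gamma0 4) (hc : γ 1 0 ≠ 0) :
    ∃ n m : ℤ, ((γ * ModularGroup.T ^ n * W4 ^ m) 1 0).natAbs < (γ 1 0).natAbs := by
  have hent : ∀ n m : ℤ,
      (γ * ModularGroup.T ^ n * W4 ^ m) 1 0 = γ 1 0 + 4 * m * (γ 1 0 * n + γ 1 1) := by
    intro n m
    obtain ⟨w00, w01, w10, w11⟩ := coe_W4_zpow m
    simp only [Matrix.SpecialLinearGroup.coe_mul, Matrix.mul_apply, Fin.sum_univ_two, w00,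
      w10, ModularGroup.coe_T_zpow, Matrix.of_apply, Matrix.cons_val', Matrix.cons_val_zero,
      Matrix.cons_val_one, Matrix.empty_val', Matrix.cons_val_fin_one]
    ring
  obtain ⟨n, m, hlt⟩ := descent_arith hc (four_dvd_c_of_mem_Gamma0 hγ)
    (Int.odd_iff.mp (odd_d_of_mem_Gamma0 hγ))
  refine ⟨n, m, ?_⟩
  rw [hent, ← Int.ofNat_lt, Int.natCast_natAbs, Int.natCast_natAbs]
  exact hlt

/-- The law for every `γ ∈ Γ₀(4)`, by strong induction on `|c|`. [folklore] -/
theorem thetaTransfAt_of_mem_Gamma0 {γ : SL(2, ℤ)} (hγ : γ ∈ Gamma0 4) : ThetaTransfAt γ := by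
  suffices ∀ (n : ℕ) (γ : SL(2, ℤ)), γ ∈ Gamma0 4 → (γ 1 0).natAbs = n → ThetaTransfAt γ from
    this _ γ hγ rfl
  intro n
  induction n using Nat.strong_induction_on with
  | _ n ih =>
    intro γ hγ hn
    by_cases hc : γ 1 0 = 0
    · exact thetaTransfAt_of_c_eq_zero hc
    obtain ⟨k, m, hlt⟩ := exists_descent hγ hc
    have hT : ModularGroup.T ∈ Gamma0 4 := modularT_mem_Gamma0 4
    have hmemk : γ * ModularGroup.T ^ k ∈ Gamma0 4 := mul_mem hγ (zpow_mem hT k)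
    have hmem : γ * ModularGroup.T ^ k * W4 ^ m ∈ Gamma0 4 :=
      mul_mem hmemk (zpow_mem W4_mem_Gamma0 m)
    have h1 : ThetaTransfAt (γ * ModularGroup.T ^ k * W4 ^ m) := ih _ (hn ▸ hlt) _ hmem rfl
    have h2 : ThetaTransfAt (γ * ModularGroup.T ^ k) := by
      have := thetaTransfAt_mul_W4_zpow hmem h1 (-m)
      rwa [mul_assoc (γ * _), ← zpow_add, add_neg_cancel, zpow_zero, mul_one] at this
    have := thetaTransfAt_mul_T_zpow hmemk h2 (-k)
    rwa [mul_assoc, ← zpow_add, add_neg_cancel, zpow_zero, mul_one] at this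

/-! ### Main statements -/

/-- **The transformation law of `θ` on `Γ₀(4)`** (Shimura 1973, §1; Koblitz IV §1;
Knopp Ch. 4, Thm. 3 for `ϑ`): for `γ = (a b; c d) ∈ Γ₀(4)` and `z ∈ ℍ`,
`θ(γz) = ε_d⁻¹ · (c/d) · √(cz + d) · θ(z)`, with `ε_d = 1, i` according as `d ≡ 1, 3 (mod 4)`,
Shimura's symbol `(c/d)` (`shimuraSymbol`) and the principal square root.
[cite: Shimura1973HalfIntegral, §1] -/
theorem shimuraTheta_smul_eq {γ : SL(2, ℤ)} (hγ : γ ∈ Gamma0 4) (z : ℍ) :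
    shimuraTheta (γ • z) = (thetaEps (γ 1 1))⁻¹ * (shimuraSymbol (γ 1 0) (γ 1 1) : ℂ) *
      Complex.sqrt ((γ 1 0 : ℂ) * z + γ 1 1) * shimuraTheta z :=
  thetaTransfAt_of_mem_Gamma0 hγ z

/-- `Γ₀(N) ≤ Γ₀(4)` for `4 ∣ N` (also `N = 0`, where `Γ₀(0) = {±Tⁿ}`); cf.
`gamma0_le_gamma0_of_dvd` in `ModularCurveGenusTwoProofs` (not imported here). [folklore] -/
theorem mem_Gamma0_four_of_dvd {N : ℕ} (hN : 4 ∣ N) {γ : SL(2, ℤ)} (hγ : γ ∈ Gamma0 N) :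
    γ ∈ Gamma0 4 := by
  rw [Gamma0_mem] at hγ ⊢
  rw [ZMod.intCast_zmod_eq_zero_iff_dvd] at hγ ⊢
  exact dvd_trans (Int.natCast_dvd_natCast.mpr hN) hγ

/-- The transformation law for `γ ∈ Γ₀(N)`, `4 ∣ N` (the levels of `M_{k/2}(N, χ)`), stated with
`thetaFactor`: `θ(γz) = j(γ, z) θ(z)`. [cite: Shimura1973HalfIntegral, §1] -/
theorem shimuraTheta_smul_eq_thetaFactor {N : ℕ} (hN : 4 ∣ N) {γ : SL(2, ℤ)} (hγ : γ ∈ Gamma0 N)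
    (z : ℍ) : shimuraTheta (γ • z) = thetaFactor (γ 1 0) (γ 1 1) z * shimuraTheta z :=
  thetaTransfAt_of_mem_Gamma0 (mem_Gamma0_four_of_dvd hN hγ) z

/-- `(c/d)² = 1` when `gcd(c, d) = 1`. [folklore] -/
theorem shimuraSymbol_sq {c d : ℤ} (h : Int.gcd c d = 1) : shimuraSymbol c d ^ 2 = 1 := by
  unfold shimuraSymbol
  have hg : c.gcd d.natAbs = 1 := by simpa [Int.gcd, Int.natAbs_abs] using h
  rw [mul_pow, jacobiSym.sq_one hg]
  split_ifs <;> norm_num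

/-- In `SL₂(ℤ)`, `gcd(c, d) = 1`. [folklore] -/
theorem gcd_c_d_eq_one (γ : SL(2, ℤ)) : Int.gcd (γ 1 0) (γ 1 1) = 1 := by
  rw [Int.gcd_comm]
  exact SL2Z_gcd_eq_one (det_entries γ)

/-- **`j(γ, z) ≠ 0`** (for `gcd(c, d) = 1`, e.g. the bottom row of any `γ ∈ SL₂(ℤ)`).
[folklore] -/
theorem thetaFactor_ne_zero {c d : ℤ} (h : Int.gcd c d = 1) (z : ℍ) : thetaFactor c d z ≠ 0 := by
  unfold thetaFactor
  refine mul_ne_zero (mul_ne_zero (inv_ne_zero (thetaEps_ne_zero d)) ?_) ?_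
  · have h1 := shimuraSymbol_sq h
    have : shimuraSymbol c d ≠ 0 := fun h0 ↦ by rw [h0] at h1; norm_num at h1
    exact_mod_cast this
  · intro h0
    have hlin : (c : ℂ) * z + d = 0 := by rw [← csqrt_sq ((c : ℂ) * z + d), h0]; ring
    have hne : ((![(c : ℝ), (d : ℝ)] 0 : ℝ) : ℂ) * z + (![(c : ℝ), (d : ℝ)] 1 : ℝ) ≠ 0 := by
      apply UpperHalfPlane.linear_ne_zero
      intro hcd
      have hc : (c : ℝ) = 0 := by simpa using congrFun hcd 0
      have hd : (d : ℝ) = 0 := by simpa using congrFun hcd 1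
      rw [show c = 0 by exact_mod_cast hc, show d = 0 by exact_mod_cast hd] at h
      simp at h
    exact hne (by simpa using hlin)

/-- **`j(γ, z)² = χ₋₄(d) (cz + d)`**: the square of the weight-`1/2` factor is the weight-`1`
factor with the character `χ₋₄(d) = ±1` (`d ≡ ±1 mod 4`), i.e. `θ² |₁ γ = χ₋₄(d) θ²` on `Γ₀(4)`.
[folklore] -/
theorem thetaFactor_sq {c d : ℤ} (h : Int.gcd c d = 1) (z : ℍ) :
    thetaFactor c d z ^ 2 = (if d % 4 = 3 then -1 else 1) * ((c : ℂ) * z + d) := by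
  unfold thetaFactor
  rw [mul_pow, mul_pow, csqrt_sq, thetaEps_inv_sq, ← Int.cast_pow, shimuraSymbol_sq h]
  push_cast
  ring

/-- **`θ(γz)² = χ₋₄(d) (cz + d) θ(z)²`** for `γ ∈ Γ₀(4)`: `θ²` is a modular form of weight `1`
for `Γ₀(4)` with character `χ₋₄`. [folklore] -/
theorem shimuraTheta_sq_smul {γ : SL(2, ℤ)} (hγ : γ ∈ Gamma0 4) (z : ℍ) :
    shimuraTheta (γ • z) ^ 2 =
      (if γ 1 1 % 4 = 3 then -1 else 1) * ((γ 1 0 : ℂ) * z + γ 1 1) * shimuraTheta z ^ 2 := by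
  rw [thetaTransfAt_of_mem_Gamma0 hγ z, mul_pow, thetaFactor_sq (gcd_c_d_eq_one γ)]

end Literature.NumberTheory.EllipticCurves.ModularForms
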